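import Summits.Ventures.QEC.Census.CertCheck
import Summits.Ventures.QEC.Census.CertCheckBZ
import Literature.InformationTheory.QuantumCodes.ShorCodeFamily
import Literature.InformationTheory.QuantumCodes.CSSEquivalence
import Literature.InformationTheory.QuantumCodes.OptimalRadius
import Literature.InformationTheory.QuantumCodes.ShorCodeMajorityDecoder
import Literature.InformationTheory.QuantumCodes.CSSDecoderReindex
import HarnessLib

/-!
# Census calibration row `cal_Shor9` IS Shor's nine-qubit code `ShorCode.code 3` (block-major re-indexing): `⟦9, 1, 3⟧` at
# tier KERNEL-std by the family theorem, and its Q4 radius row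

LADDER-QEC (venture cell `qec`), PARTITION row 08, item 118 «08.SHOR» (Summits-side link of the Literature family theorem
`ShorCode.code_isCode : (ShorCode.code m).IsCode (m*m) 1 m`, file `Literature/InformationTheory/QuantumCodes/ShorCodeFamily.lean`,
to the census). The calibration row `cal_Shor9` of census/TABLE.tsv (family `calibration(search-2_gens`, cell C.0; generators
file `census/search-2/gens/06_Shor_9_1_3.json`, «standard 9-qubit Shor code built from its definition (Z_iZ_{i+1} inside each
3-block; X on blocks 12 and 23)», qubit order block-major; certA `6f02a00350cb65f0` ∧ certB `c935ccff845e7f2f`, ref-1 signed;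
`lean_pid` pending — the one calibration row still at tier COMPUTED) has check rows, VERBATIM from the generators file,

  `H_X`: `{0,1,2,3,4,5}`, `{3,4,5,6,7,8}`;   `H_Z`: `{0,1}`, `{1,2}`, `{3,4}`, `{4,5}`, `{6,7}`, `{7,8}`.

This file types that object as `cal_Shor9.code = CSSCode.ofMatrices (rowMatrix 9 HX) (rowMatrix 9 HZ) _` (the census's
`rowMatrix`/`maskOf` words, bit `j` = qubit `j`) and proves that along the block-major bijection `σ : q ↦ (q / 3, q % 3)`
(and the evident check-row bijections) its check matrices ARE those of `ShorCode.code 3` (`HX_eq_submatrix`, `HZ_eq_submatrix`,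
`decide +kernel` on 0/1 matrices), so by the tree's FACT P (`CSSCode.isCode_iff_of_submatrix`, Lin–Pryadko 2024 Thm 6) the
census object is `⟦9,1,3⟧` BECAUSE Shor's `3 × 3` code is (`isCode`, from `ShorCode.shor9_isCode`) — with `dX_eq`/`dZ_eq`/`k_eq`
transported too — and its Q4 radius-column entry `hasOptimalRadius : cal_Shor9.code.HasOptimalRadius 1` follows
(`CSSCode.IsCode.hasOptimalRadius_of_eq`). Tier KERNEL-std (`decide` / `decide +kernel` only on the 9-qubit tables; axioms
standard). HONEST FRAMING: a calibration code; the certificates of record (certA ∧ certB) stay the row's census evidence; this is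
the theorem-lane derivation of the same parameters + the structural identification. No novelty.

References: [Shor1995] (the nine-qubit code); [NielsenChuang2010] §10.2 + Exercise 10.5 (chunk p0510 L3–7: the stabilizers
`Z₁Z₂, Z₂Z₃, …` and `X₁…X₆`, `X₄…X₉`); [LinPryadko2024] arXiv:2306.16400 §4.2 Thm 6 (permutation equivalence preserves parameters).
-/

namespace Summit.Ventures.QEC.Census

open Matrix Literature.InformationTheory.QuantumCodes

namespace cal_Shor9

/-- The `X`-check rows of census row `cal_Shor9` as words (bit `j` = qubit `j`): supports `{0,…,5}` and `{3,…,8}` — the rows of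
`census/search-2/gens/06_Shor_9_1_3.json` verbatim («X on blocks 12 and 23»). (definition) [cite: NielsenChuang2010, §10.2 Exercise 10.5 (chunk p0510 L7: X₁X₂X₃X₄X₅X₆ and X₄X₅X₆X₇X₈X₉)] -/
def HX : List ℕ := [maskOf [0, 1, 2, 3, 4, 5], maskOf [3, 4, 5, 6, 7, 8]]

/-- The `Z`-check rows of census row `cal_Shor9`: supports `{0,1}, {1,2}, {3,4}, {4,5}, {6,7}, {7,8}` («Z_iZ_{i+1} inside each
3-block»), verbatim from the generators file. (definition) [cite: NielsenChuang2010, §10.2 (chunk p0510 L3: «comparing the first and second qubits, and then the second and third»)] -/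
def HZ : List ℕ := [maskOf [0, 1], maskOf [1, 2], maskOf [3, 4], maskOf [4, 5], maskOf [6, 7], maskOf [7, 8]]

/-- The check rows commute (`commOK`, `decide`). [cite: NielsenChuang2010, §10.2 (chunk p0510 L3–7)] -/
theorem commOK_HX_HZ : commOK 9 HX HZ = true := by decide

/-- **The census object `cal_Shor9`** as a check-matrix CSS code on `Fin 9` (the census's `rowMatrix` form). (definition)
[cite: Shor1995, (the nine-qubit code)] -/
def code : CSSCode (Fin HX.length) (Fin HZ.length) (Fin 9) :=
  CSSCode.ofMatrices (rowMatrix 9 HX) (rowMatrix 9 HZ) (comm_of_commOK commOK_HX_HZ)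

/-- The block-major qubit bijection `q ↦ (q / 3, q % 3)` (block, position). (definition) [cite: NielsenChuang2010, §10.2 (chunk p0509 L11: three blocks of three qubits)] -/
def σ (q : Fin 9) : Fin 3 × Fin 3 := (⟨q.val / 3 % 3, Nat.mod_lt _ (by decide)⟩, ⟨q.val % 3, Nat.mod_lt _ (by decide)⟩)

/-- The `X`-check bijection: census `X`-row `r ↦` block pair `r` of `ShorCode.code 3`. (definition) [cite: NielsenChuang2010, §10.2 Exercise 10.5 (chunk p0510 L7)] -/
def ρX (r : Fin HX.length) : Fin (3 - 1) := ⟨r.val % 2, Nat.mod_lt _ (by decide)⟩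

/-- The `Z`-check bijection: census `Z`-row `r ↦` (block `r / 2`, pair `r % 2`) of `ShorCode.code 3`. (definition) [cite: NielsenChuang2010, §10.2 (chunk p0510 L3)] -/
def ρZ (r : Fin HZ.length) : Fin 3 × Fin (3 - 1) := (⟨r.val / 2 % 3, Nat.mod_lt _ (by decide)⟩, ⟨r.val % 2, Nat.mod_lt _ (by decide)⟩)

/-- `σ` is a bijection. [cite: LinPryadko2024, §4.2 Thm 6 (arXiv:2306.16400 p0009 L66-74: permutation equivalence)] -/
theorem σ_bijective : Function.Bijective σ := by decide

/-- `ρX` is a bijection. [cite: LinPryadko2024, §4.2 Thm 6 (arXiv:2306.16400 p0009 L66-74)] -/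
theorem ρX_bijective : Function.Bijective ρX := by decide

/-- `ρZ` is a bijection. [cite: LinPryadko2024, §4.2 Thm 6 (arXiv:2306.16400 p0009 L66-74)] -/
theorem ρZ_bijective : Function.Bijective ρZ := by decide

/-- **Along the bijections the census `X`-check matrix IS `ShorCode.HX 3`.** [cite: NielsenChuang2010, §10.2 Exercise 10.5 (chunk p0510 L7)] -/
theorem HX_eq_submatrix :
    code.HX = (ShorCode.code 3).HX.submatrix (Equiv.ofBijective ρX ρX_bijective) (Equiv.ofBijective σ σ_bijective) := by
  show rowMatrix 9 HX = _
  decide +kernel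

/-- **Along the bijections the census `Z`-check matrix IS `ShorCode.HZ 3`.** [cite: NielsenChuang2010, §10.2 (chunk p0510 L3)] -/
theorem HZ_eq_submatrix :
    code.HZ = (ShorCode.code 3).HZ.submatrix (Equiv.ofBijective ρZ ρZ_bijective) (Equiv.ofBijective σ σ_bijective) := by
  show rowMatrix 9 HZ = _
  decide +kernel

/-- **`cal_Shor9` is a re-indexing of `ShorCode.code 3`** (FACT P). [cite: LinPryadko2024, §4.2 Thm 6 (arXiv:2306.16400 p0009 L66-74)] -/
theorem eq_reindex_shor :
    code = (ShorCode.code 3).reindex (Equiv.ofBijective ρX ρX_bijective).symm (Equiv.ofBijective ρZ ρZ_bijective).symm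
      (Equiv.ofBijective σ σ_bijective).symm :=
  CSSCode.eq_reindex_of_submatrix HX_eq_submatrix HZ_eq_submatrix

/-- **The census code `cal_Shor9` is `[[n,k,d]]` iff Shor's `3 × 3` code is.** [cite: LinPryadko2024, §4.2 Thm 6 (arXiv:2306.16400 p0009 L66-91: equivalent codes have the same parameters)] -/
theorem isCode_iff_shor (n k d : ℕ) : code.IsCode n k d ↔ (ShorCode.code 3).IsCode n k d :=
  CSSCode.isCode_iff_of_submatrix HX_eq_submatrix HZ_eq_submatrix n k d

/-- `k = 1` for the census object (transported from `ShorCode.code_k`). [cite: NielsenChuang2010, §10.2 (chunk p0509 L11)] -/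
theorem k_eq : code.k = 1 := by
  rw [CSSCode.k_eq_of_submatrix HX_eq_submatrix HZ_eq_submatrix]; exact ShorCode.code_k (m := 3) (by norm_num)

/-- `d_X = 3` for the census object (transported from `ShorCode.code_dX`). [cite: NguyenEtAl2021, §II (arXiv:2104.01205 chunk p0002 L11: «differ by at least m bit- … flips»)] -/
theorem dX_eq : code.dX = 3 := by
  rw [CSSCode.dX_eq_of_submatrix HX_eq_submatrix HZ_eq_submatrix]; exact ShorCode.code_dX (m := 3) (by norm_num)

/-- `d_Z = 3` for the census object (transported from `ShorCode.code_dZ`). [cite: NguyenEtAl2021, §II (arXiv:2104.01205 chunk p0002 L11: «… or phase-flips»)] -/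
theorem dZ_eq : code.dZ = 3 := by
  rw [CSSCode.dZ_eq_of_submatrix HX_eq_submatrix HZ_eq_submatrix]; exact ShorCode.code_dZ (m := 3) (by norm_num)

/-- **Census row `cal_Shor9` is `⟦9, 1, 3⟧` BY THE FAMILY THEOREM** (`ShorCode.shor9_isCode`) — tier KERNEL-std; the row's
certificates of record (certA `6f02a003…` ∧ certB `c935ccff…`) remain its census evidence. [cite: Shor1995, (the nine-qubit code)] [cite: NielsenChuang2010, §10.2 (chunk p0509 L11: «protect against the effects of an arbitrary error on a single qubit»)] -/
theorem isCode : code.IsCode 9 1 3 := (isCode_iff_shor 9 1 3).2 ShorCode.shor9_isCode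

/-- **Q4 radius column of `cal_Shor9`**: correction radius `1 = ⌊(3−1)/2⌋`, attained by sector-wise minimum-weight decoding, and no
Pauli decoder corrects every Pauli error of weight `≤ 2`. (proved) [cite: Gottesman1997, §2.3 (chunk p0014 L3)] [cite: NielsenChuang2010, §10.2 (chunk p0509 L11)] -/
theorem hasOptimalRadius : code.HasOptimalRadius 1 := isCode.hasOptimalRadius_of_eq rfl

/-! ### The explicit decoder of the census object (appended 2026-08-27, qec-type-08 gen 5) -/

/-- **The census object `cal_Shor9` inherits Shor's MAJORITY-VOTE bit-flip decoder** (item 127, `ShorCode.majorityX`,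
transported along the identification `eq_reindex_shor` by `Decoder.reindexX`): it corrects every single `X`-error of
`cal_Shor9.code` — an explicit, computable decoder with certified radius `1` for this census row.
[cite: NielsenChuang2010, §10.2 (chunk p0510 L3)] [cite: LinPryadko2024, §4.2 Thm 6 (arXiv:2306.16400 p0009 L66-74)] -/
theorem majorityX_correctsUpTo :
    ((ShorCode.majorityX (m := 3)).reindexX (Equiv.ofBijective ρZ ρZ_bijective).symm
        (Equiv.ofBijective σ σ_bijective).symm).CorrectsUpTo code.xSyndrome (code.rowSpX : Set (Fin 9 → ZMod 2))
      hammingNorm 1 := by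
  rw [eq_reindex_shor]
  exact (Decoder.reindexX_correctsUpTo_iff _ _ _ _ _ 1).2 (ShorCode.majorityX_correctsUpTo 3)

/-- **… and Shor's majority-vote phase-flip decoder** (`ShorCode.majorityZ` transported): it corrects every single
`Z`-error of `cal_Shor9.code`. [cite: NielsenChuang2010, §10.2 (chunk p0510 L5–7)] [cite: LinPryadko2024, §4.2 Thm 6 (arXiv:2306.16400 p0009 L66-74)] -/
theorem majorityZ_correctsUpTo :
    ((ShorCode.majorityZ (m := 3)).reindexZ (Equiv.ofBijective ρX ρX_bijective).symm
        (Equiv.ofBijective σ σ_bijective).symm).CorrectsUpTo code.zSyndrome (code.rowSpZ : Set (Fin 9 → ZMod 2))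
      hammingNorm 1 := by
  rw [eq_reindex_shor]
  exact (Decoder.reindexZ_correctsUpTo_iff _ _ _ _ _ 1).2 (ShorCode.majorityZ_correctsUpTo 3)

end cal_Shor9

end Summit.Ventures.QEC.Census
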